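import Summits.KontsevichZagierPeriods.KontsevichZagierPeriods.Theorems.RootDecompRelativeModAbsoluteRegFoldingDegOneP10

/-!
# `RegFoldingDegOne` (route `RootDecompRelativeModAbsolute`, support item stmt-KontsevichZagierPeriods-30571) — PROVED · part 11/14

Cell `decomp-kz`, lens 3 (decomp-kz-lens-3 g9): `regFoldingDegOne_holds :
Theses.RootDecompRelativeModAbsolute.RegFoldingDegOne` BY NAME (in part 14/14) — every Kontsevich–Zagier
integral representation on `ℝ²` whose integrand is a quotient `p/q` of `ℚ`-polynomials with `deg_t q ≤ 1`,
`q ≠ 0` on the domain, is equivalent in `KZ.relations` to `[g] + Σᵢ [Uᵢ]`, the `Uᵢ` honest 2-cells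
`[g.domain × (0,1), hᵢ(x) θ^{Mᵢ}/(1 + θ^{eᵢ} κᵢ(x))]` (unfolded REGULARISED log/arctan monomials), with the
fibre integrals matching a.e.  Architecture: §1–§2 regularised terms `RTerm`, `RegFolding d`; §7 a.e.-congruence;
§8 gluing (`FoldsTo`); §9 one-band toolkit; §P analytic core (kernel independence); §10 cylinders; §11 affine band
chart; §13 `RegFolding 1` from a CAD band cover a.e. + vanishing on unbounded bands; last part: the edge to the born
item text and `regFoldingDegOne_holds`.

Source: `HOME/decomp-kz-lens-3/g9/landing/RootDecompRelativeModAbsoluteRegFoldingDegOne.lean` sha256 60038aa44a5f6303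
(4275 l; critic decomp-kz-crit-1 g2 CLEARED/kernel-confirmed 2026-08-30T09:41:19Z, std axioms), split mechanically
into 14 modules ≤ 400 lines by the landing seat decomp-kz-census-1 g7 (contexts re-opened per part; generic docstrings
added where the source had none; parts 1–13 do not import the route file).  No `sorry`; standard axioms.
References: [cite: KontsevichZagier2001, §1.2]; Basu–Pollack–Roy 2006 Def. 5.1 / Cor. 5.7; Bochnak–Coste–Roy 1998 §2.9.
-/

noncomputable section

open Set MeasureTheory Filter Topology
open scoped BigOperators
open Literature.NumberTheory.Transcendental Literature.ModelTheory.ExponentialFields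

namespace Summit.KontsevichZagierPeriods.RootDecompRelativeModAbsolute.Rung30571

-- PRIVATE copy (twin landed in …LogFoldingDegOne/Negative; dedup.landed): not_integrableOn_inv_Ioo
/-- `1/θ ∉ L¹(0,1)`. [folklore] -/
private theorem not_integrableOn_inv_Ioo : ¬ IntegrableOn (fun t : ℝ => t⁻¹) (Ioo (0 : ℝ) 1) := by
  intro h
  rcases (intervalIntegrable_inv_iff (a := (0 : ℝ)) (b := 1)).1
    ((intervalIntegrable_iff_integrableOn_Ioo_of_le zero_le_one).2 h) with h01 | hmem
  · exact zero_ne_one h01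
  · exact hmem (by simp)

-- PRIVATE copy (landed twin in farm-unbuilt HyperbolicBloch module; dedup.landed): isSemialgebraicFunOn_finset_sum
/-- Finite sums of `ℚ`-semialgebraic functions are `ℚ`-semialgebraic. [BCR 1998, Prop. 2.2.6] -/
private theorem isSemialgebraicFunOn_finset_sum {n : ℕ} {s : Set (Fin n → ℝ)} (hs : IsSemialgebraic ℚ s)
    {ι : Type*} (I : Finset ι) {f : ι → (Fin n → ℝ) → ℝ}
    (hf : ∀ i ∈ I, IsSemialgebraicFunOn ℚ s (f i)) :
    IsSemialgebraicFunOn ℚ s (fun x => ∑ i ∈ I, f i x) := by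
  classical
  induction I using Finset.induction_on with
  | empty => exact (isSemialgebraicFunOn_ratCast hs 0).congr fun x _ => by simp
  | insert a I ha ih =>
    have h1 : IsSemialgebraicFunOn ℚ s (f a) := hf a (Finset.mem_insert_self a I)
    have h2 := ih fun i hi => hf i (Finset.mem_insert_of_mem hi)
    refine (IsSemialgebraicFunOn.add_holds h1 h2).congr fun x _ => ?_
    simp only [Pi.add_apply, Finset.sum_insert ha]

namespace RegularisedLogLayer

section DegOnePieces

variable {b : ℕ}

/-- Piece `A = 0` (pole on the section `θ = 0`; the residue `c₀/B` dies a.e.). -/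
theorem foldsTo_ratDegOne_pieceA (r : KZ.IntegralRep (b + 1)) {P : Set (Fin b → ℝ)}
    (hP : IsSemialgebraic ℚ P) (n : ℕ) {c : ℕ → (Fin b → ℝ) → ℝ}
    (hc : ∀ i, IsSemialgebraicFunOn ℚ P (c i)) {A B : (Fin b → ℝ) → ℝ}
    (hB : IsSemialgebraicFunOn ℚ P B) (hA0 : ∀ x ∈ P, A x = 0) (hB0 : ∀ x ∈ P, B x ≠ 0)
    (hdom : r.domain = RTerm.cyl P)
    (hint : EqOn r.integrand (fun z =>
      (∑ i ∈ Finset.range (n + 1), c i (Fin.init z) * z (Fin.last b) ^ i) /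
        (A (Fin.init z) + B (Fin.init z) * z (Fin.last b))) r.domain) :
    ∃ (T : RTerm b) (hT : T.Admissible), FoldsTo r T hT := by
  have hcyl : IsSemialgebraic ℚ (RTerm.cyl P) := RTerm.isSemialgebraic_cyl hP
  set a : ℕ → (Fin b → ℝ) → ℝ := fun j x => c (j + 1) x / B x with ha_def
  set e : (Fin b → ℝ) → ℝ := fun x => c 0 x / B x with he_def
  have ha : ∀ j, IsSemialgebraicFunOn ℚ P (a j) := fun j => (hc (j + 1)).div hB hB0
  have hform : EqOn r.integrand (fun z =>
      (∑ k ∈ Finset.range n, a k (Fin.init z) * z (Fin.last b) ^ k) +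
        e (Fin.init z) * (fun t : ℝ => t⁻¹) (z (Fin.last b))) r.domain := by
    intro z hz
    have hz' : z ∈ RTerm.cyl P := hdom ▸ hz
    rw [hint hz]
    exact ratDegOne_pole_zero_form n (fun i => c i (Fin.init z)) (hA0 _ hz'.1) (hB0 _ hz'.1)
      hz'.2.1.ne'
  have hae := ae_eq_zero_of_pole r hP hdom n a e not_integrableOn_inv_Ioo hform
  set W : (Fin (b + 1) → ℝ) → ℝ := fun z =>
    ∑ k ∈ Finset.range n, a k (Fin.init z) * z (Fin.last b) ^ k with hW
  have hWsa : IsSemialgebraicFunOn ℚ (RTerm.cyl P) W :=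
    isSemialgebraicFunOn_finset_sum hcyl _ fun k _ =>
      IsSemialgebraicFunOn.mul_holds ((ha k).comp_init_mono hcyl fun z hz => hz.1)
        (isSemialgebraicFunOn_pow hcyl (isSemialgebraicFunOn_apply hcyl (Fin.last b)) k)
  have haeW : ∀ᵐ z : (Fin (b + 1) → ℝ), z ∈ r.domain → r.integrand z = W z := by
    filter_upwards [ae_cyl_of_ae_base hae] with z hz hzd
    have hz' : z ∈ RTerm.cyl P := hdom ▸ hzd
    simp only [hform hzd, hz hz', hW, zero_mul, add_zero]
  have hWi : IntegrableOn W (RTerm.cyl P) := by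
    have hri : IntegrableOn r.integrand (RTerm.cyl P) := hdom ▸ r.integrableOn
    refine hri.congr_fun_ae ?_
    exact (ae_restrict_iff' hcyl.measurableSet_holds).2
      (haeW.mono fun z hz hzP => hz (by rw [hdom]; exact hzP))
  let r' : KZ.IntegralRep (b + 1) := ⟨RTerm.cyl P, W, hcyl, hWsa, hWi⟩
  obtain ⟨T, hT, hf⟩ := foldsTo_cyl_polynomial_range r' hP n ha rfl (fun z _ => rfl)
  exact ⟨T, hT, FoldsTo.of_ae_eq (r' := r') hdom haeW hf⟩

/-- Piece `A ≠ 0`, `A + B = 0` (pole on the section `θ = 1`; Horner division by `1 − θ`, the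
residue `N(x,1)/A` dies a.e.). -/
theorem foldsTo_ratDegOne_pieceOne (r : KZ.IntegralRep (b + 1)) {P : Set (Fin b → ℝ)}
    (hP : IsSemialgebraic ℚ P) (n : ℕ) {c : ℕ → (Fin b → ℝ) → ℝ}
    (hc : ∀ i, IsSemialgebraicFunOn ℚ P (c i)) {A B : (Fin b → ℝ) → ℝ}
    (hA : IsSemialgebraicFunOn ℚ P A) (hA0 : ∀ x ∈ P, A x ≠ 0) (hAB : ∀ x ∈ P, A x + B x = 0)
    (hdom : r.domain = RTerm.cyl P)
    (hint : EqOn r.integrand (fun z =>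
      (∑ i ∈ Finset.range (n + 1), c i (Fin.init z) * z (Fin.last b) ^ i) /
        (A (Fin.init z) + B (Fin.init z) * z (Fin.last b))) r.domain) :
    ∃ (T : RTerm b) (hT : T.Admissible), FoldsTo r T hT := by
  have hcyl : IsSemialgebraic ℚ (RTerm.cyl P) := RTerm.isSemialgebraic_cyl hP
  have hm1 : IsSemialgebraicFunOn ℚ P (fun _ => (-1 : ℝ)) :=
    (isSemialgebraicFunOn_ratCast hP (-1)).congr fun x _ => by simp
  set a : ℕ → (Fin b → ℝ) → ℝ := fun j x => horCoeff n (fun i => c i x) (-1) j / A x with ha_def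
  set e : (Fin b → ℝ) → ℝ := fun x => horRem n (fun i => c i x) (-1) / A x with he_def
  have ha : ∀ j, IsSemialgebraicFunOn ℚ P (a j) := fun j =>
    (isSemialgebraicFunOn_horCoeff hP n hc hm1 (fun x _ => by norm_num) j).div hA hA0
  have hform : EqOn r.integrand (fun z =>
      (∑ k ∈ Finset.range (n + 1), a k (Fin.init z) * z (Fin.last b) ^ k) +
        e (Fin.init z) * (fun t : ℝ => (1 - t)⁻¹) (z (Fin.last b))) r.domain := by
    intro z hz
    have hz' : z ∈ RTerm.cyl P := hdom ▸ hz
    rw [hint hz]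
    exact ratDegOne_pole_one_form n (fun i => c i (Fin.init z)) (hA0 _ hz'.1) (hAB _ hz'.1)
      hz'.2.2.ne
  have hae := ae_eq_zero_of_pole r hP hdom (n + 1) a e not_integrableOn_inv_one_sub_Ioo hform
  set W : (Fin (b + 1) → ℝ) → ℝ := fun z =>
    ∑ k ∈ Finset.range (n + 1), a k (Fin.init z) * z (Fin.last b) ^ k with hW
  have hWsa : IsSemialgebraicFunOn ℚ (RTerm.cyl P) W :=
    isSemialgebraicFunOn_finset_sum hcyl _ fun k _ =>
      IsSemialgebraicFunOn.mul_holds ((ha k).comp_init_mono hcyl fun z hz => hz.1)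
        (isSemialgebraicFunOn_pow hcyl (isSemialgebraicFunOn_apply hcyl (Fin.last b)) k)
  have haeW : ∀ᵐ z : (Fin (b + 1) → ℝ), z ∈ r.domain → r.integrand z = W z := by
    filter_upwards [ae_cyl_of_ae_base hae] with z hz hzd
    have hz' : z ∈ RTerm.cyl P := hdom ▸ hzd
    simp only [hform hzd, hz hz', hW, zero_mul, add_zero]
  have hWi : IntegrableOn W (RTerm.cyl P) := by
    have hri : IntegrableOn r.integrand (RTerm.cyl P) := hdom ▸ r.integrableOn
    refine hri.congr_fun_ae ?_
    exact (ae_restrict_iff' hcyl.measurableSet_holds).2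
      (haeW.mono fun z hz hzP => hz (by rw [hdom]; exact hzP))
  let r' : KZ.IntegralRep (b + 1) := ⟨RTerm.cyl P, W, hcyl, hWsa, hWi⟩
  obtain ⟨T, hT, hf⟩ := foldsTo_cyl_polynomial_range r' hP (n + 1) ha rfl (fun z _ => rfl)
  exact ⟨T, hT, FoldsTo.of_ae_eq (r' := r') hdom haeW hf⟩

/-- Piece `A ≠ 0`, `A + B ≠ 0`, `|B/A| ≤ η₁`: TAYLOR regularisation (kernel order `n + 1`). -/
theorem foldsTo_ratDegOne_pieceTaylor (r : KZ.IntegralRep (b + 1)) {P : Set (Fin b → ℝ)}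
    (hP : IsSemialgebraic ℚ P) (n : ℕ) {c : ℕ → (Fin b → ℝ) → ℝ}
    (hc : ∀ i, IsSemialgebraicFunOn ℚ P (c i)) {A B : (Fin b → ℝ) → ℝ}
    (hA : IsSemialgebraicFunOn ℚ P A) (hB : IsSemialgebraicFunOn ℚ P B)
    (hA0 : ∀ x ∈ P, A x ≠ 0) (hAB : ∀ x ∈ P, A x + B x ≠ 0)
    (hne : ∀ x ∈ P, ∀ θ ∈ Ioo (0 : ℝ) 1, A x + B x * θ ≠ 0)
    {η₁ : ℝ} (hT : ∃ cT : ℝ, 0 < cT ∧ ∀ κ' : ℝ, |κ'| ≤ η₁ → ∀ (a' : Fin (n + 1) → ℝ) (b' : ℝ),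
      cT * (∑ k, |a' k| + |b'|) ≤
        ∫ θ in Ioo (0 : ℝ) 1, |∑ k : Fin (n + 1), a' k * θ ^ (k : ℕ) + b' * θ ^ (n + 1) / (1 + κ' * θ)|)
    (hsmall : ∀ x ∈ P, |B x / A x| ≤ η₁)
    (hdom : r.domain = RTerm.cyl P)
    (hint : EqOn r.integrand (fun z =>
      (∑ i ∈ Finset.range (n + 1), c i (Fin.init z) * z (Fin.last b) ^ i) /
        (A (Fin.init z) + B (Fin.init z) * z (Fin.last b))) r.domain) :
    ∃ (T : RTerm b) (hT : T.Admissible), FoldsTo r T hT := by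
  obtain ⟨cT, hcT, hTay⟩ := hT
  have hPm : MeasurableSet P := hP.measurableSet_holds
  set κ : (Fin b → ℝ) → ℝ := fun x => B x / A x with hκ_def
  have hκs : IsSemialgebraicFunOn ℚ P κ := hB.div hA hA0
  have hκ1 : ∀ x ∈ P, -1 < κ x := fun x hx => neg_one_lt_ratio (hA0 x hx) (hAB x hx) (hne x hx)
  set a : ℕ → (Fin b → ℝ) → ℝ := fun k x => tayCoeff n (fun i => c i x) (κ x) k / A x with ha_def
  set h : (Fin b → ℝ) → ℝ := fun x => tayRem n (fun i => c i x) (κ x) / A x with hh_def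
  have ha : ∀ k, IsSemialgebraicFunOn ℚ P (a k) := fun k =>
    (isSemialgebraicFunOn_tayCoeff hP n hc hκs k).div hA hA0
  have hh : IsSemialgebraicFunOn ℚ P h := (isSemialgebraicFunOn_tayRem hP n hc hκs).div hA hA0
  have hpt : ∀ x ∈ P, ∀ t ∈ Ioo (0 : ℝ) 1, r.integrand (Fin.snoc x t) =
      ∑ k ∈ Finset.range (n + 1), a k x * t ^ k + h x * kernel (n + 1) 1 (κ x) t := by
    intro x hx t ht
    have hmem : (Fin.snoc x t : Fin (b + 1) → ℝ) ∈ r.domain := by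
      rw [hdom]; exact ⟨by simpa using hx, by simpa using ht⟩
    rw [hint hmem]
    simp only [Fin.init_snoc, Fin.snoc_last, ha_def, hh_def, hκ_def]
    exact ratDegOne_taylor_form n (fun i => c i x) (hA0 x hx) (hne x hx t ht)
  have hF := integrableOn_fibre_abs r hdom hPm subset_rfl (F := fun x t =>
      ∑ k : Fin (n + 1), a k x * t ^ (k : ℕ) + h x * t ^ (n + 1) / (1 + κ x * t))
    (fun x hx t ht => by
      rw [hpt x hx t ht, ← Fin.sum_univ_eq_sum_range (fun k => a k x * t ^ k) (n + 1)]
      simp only [kernel, pow_one]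
      ring)
  have hint' := integrable_coeffs_taylor_ae (μ := volume.restrict P)
    (fun x (k : Fin (n + 1)) => a k x) h κ
    (fun k => KZ.aestronglyMeasurable_of_isSemialgebraicFunOn (ha k) hPm) hcT hTay
    ((ae_restrict_mem hPm).mono fun x hx => hsmall x hx) hF
  have hai : ∀ k < n + 1, IntegrableOn (a k) P := fun k hk => hint' ⟨k, hk⟩
  exact foldsTo_cyl_poly_add_single_range r hP (n + 1) ha hai hh hκs (M := n + 1) (e := 1)
    (Or.inl rfl) hκ1 hdom (fun z hz => by
      have hz' : z ∈ RTerm.cyl P := hdom ▸ hz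
      have e := hpt (Fin.init z) hz'.1 (z (Fin.last b)) hz'.2
      rw [Fin.snoc_init_self] at e
      exact e)

/-- Piece `A ≠ 0`, `A + B ≠ 0`, `|B/A| ≥ q > 0`: HORNER regularisation (kernel order `0`). -/
theorem foldsTo_ratDegOne_pieceHorner (r : KZ.IntegralRep (b + 1)) {P : Set (Fin b → ℝ)}
    (hP : IsSemialgebraic ℚ P) (n : ℕ) {c : ℕ → (Fin b → ℝ) → ℝ}
    (hc : ∀ i, IsSemialgebraicFunOn ℚ P (c i)) {A B : (Fin b → ℝ) → ℝ}
    (hA : IsSemialgebraicFunOn ℚ P A) (hB : IsSemialgebraicFunOn ℚ P B)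
    (hA0 : ∀ x ∈ P, A x ≠ 0) (hAB : ∀ x ∈ P, A x + B x ≠ 0)
    (hne : ∀ x ∈ P, ∀ θ ∈ Ioo (0 : ℝ) 1, A x + B x * θ ≠ 0)
    {q : ℝ} (hq : 0 < q) (hbig : ∀ x ∈ P, q ≤ |B x / A x|)
    (hdom : r.domain = RTerm.cyl P)
    (hint : EqOn r.integrand (fun z =>
      (∑ i ∈ Finset.range (n + 1), c i (Fin.init z) * z (Fin.last b) ^ i) /
        (A (Fin.init z) + B (Fin.init z) * z (Fin.last b))) r.domain) :
    ∃ (T : RTerm b) (hT : T.Admissible), FoldsTo r T hT := by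
  have hPm : MeasurableSet P := hP.measurableSet_holds
  set κ : (Fin b → ℝ) → ℝ := fun x => B x / A x with hκ_def
  have hκs : IsSemialgebraicFunOn ℚ P κ := hB.div hA hA0
  have hκ1 : ∀ x ∈ P, -1 < κ x := fun x hx => neg_one_lt_ratio (hA0 x hx) (hAB x hx) (hne x hx)
  have hκ0 : ∀ x ∈ P, κ x ≠ 0 := fun x hx h0 => by
    have := hbig x hx
    rw [show B x / A x = κ x from rfl, h0, abs_zero] at this
    exact absurd this (not_le.2 hq)
  have hB0 : ∀ x ∈ P, B x ≠ 0 := fun x hx h0 => hκ0 x hx (by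
    show B x / A x = 0
    rw [h0, zero_div])
  set a : ℕ → (Fin b → ℝ) → ℝ := fun j x => horCoeff n (fun i => c i x) (κ x) j / A x with ha_def
  set h : (Fin b → ℝ) → ℝ := fun x => horRem n (fun i => c i x) (κ x) / A x with hh_def
  have ha : ∀ j, IsSemialgebraicFunOn ℚ P (a j) := fun j =>
    (isSemialgebraicFunOn_horCoeff hP n hc hκs hκ0 j).div hA hA0
  have hh : IsSemialgebraicFunOn ℚ P h :=
    (isSemialgebraicFunOn_horRem hP n hc hκs hκ0).div hA hA0
  have hpt : ∀ x ∈ P, ∀ t ∈ Ioo (0 : ℝ) 1, r.integrand (Fin.snoc x t) =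
      ∑ k ∈ Finset.range (n + 1), a k x * t ^ k + h x * kernel 0 1 (κ x) t := by
    intro x hx t ht
    have hmem : (Fin.snoc x t : Fin (b + 1) → ℝ) ∈ r.domain := by
      rw [hdom]; exact ⟨by simpa using hx, by simpa using ht⟩
    rw [hint hmem]
    simp only [Fin.init_snoc, Fin.snoc_last, ha_def, hh_def, hκ_def]
    exact ratDegOne_horner_form n (fun i => c i x) (hA0 x hx) (hB0 x hx) (hne x hx t ht)
  have hF := integrableOn_fibre_abs r hdom hPm subset_rfl (F := fun x t =>
      ∑ k : Fin (n + 1), a k x * t ^ (k : ℕ) + h x / (1 + κ x * t))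
    (fun x hx t ht => by
      rw [hpt x hx t ht, ← Fin.sum_univ_eq_sum_range (fun k => a k x * t ^ k) (n + 1)]
      simp only [kernel, pow_one, pow_zero]
      ring)
  have hint' := integrable_coeffs_away_ae (μ := volume.restrict P) hq
    (fun x (k : Fin (n + 1)) => a k x) h κ
    (fun k => KZ.aestronglyMeasurable_of_isSemialgebraicFunOn (ha k) hPm)
    ((ae_restrict_mem hPm).mono fun x hx => ⟨hκ1 x hx, hbig x hx⟩) hF
  have hai : ∀ k < n + 1, IntegrableOn (a k) P := fun k hk => hint' ⟨k, hk⟩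
  exact foldsTo_cyl_poly_add_single_range r hP (n + 1) ha hai hh hκs (M := 0) (e := 1)
    (Or.inl rfl) hκ1 hdom (fun z hz => by
      have hz' : z ∈ RTerm.cyl P := hdom ▸ hz
      have e := hpt (Fin.init z) hz'.1 (z (Fin.last b)) hz'.2
      rw [Fin.snoc_init_self] at e
      exact e)

/-! ### §10.5 The theorem -/

/-- **`t`-degree-`≤ 1` rational integrands over a cylinder fold (g9).** Let `r` be a
representation on `cyl G = G × (0,1)` (`G` `ℚ`-semialgebraic) whose integrand is
`N(x,θ)/(A(x) + B(x)θ)` with `N = Σ_{i≤n} cᵢ(x)θⁱ`, all of `cᵢ, A, B` `ℚ`-semialgebraic functions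
on `G` and `A + Bθ ≠ 0` on the cylinder. Then `r` folds: `∃ T, FoldsTo r T` — `KZ.of r ≡ KZ.of ⟦T⟧
(mod KZ.relations)` with the honest fibre-integral identity a.e. This is NODE-g8 §3quinquies steps
3–6 (endpoint split, Taylor/Horner regularisation, termwise integrability by
`Plan.endpointAnalysis`, gluing), proved by name; what remains of `RegFoldingDegOne` (30571) above
it is the chart step (`FoldsTo.of_affine` + a CAD of `r.domain` into `t`-monotone sectors).
[KZ 2001, §1.2; BCR 1998, §2.3; this file §§4–9, §P] -/
theorem foldsTo_cyl_ratDegOne (r : KZ.IntegralRep (b + 1)) {G : Set (Fin b → ℝ)}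
    (hG : IsSemialgebraic ℚ G) (n : ℕ) {c : ℕ → (Fin b → ℝ) → ℝ}
    (hc : ∀ i, IsSemialgebraicFunOn ℚ G (c i)) {A B : (Fin b → ℝ) → ℝ}
    (hA : IsSemialgebraicFunOn ℚ G A) (hB : IsSemialgebraicFunOn ℚ G B)
    (hne : ∀ x ∈ G, ∀ θ ∈ Ioo (0 : ℝ) 1, A x + B x * θ ≠ 0) (hdom : r.domain = RTerm.cyl G)
    (hint : EqOn r.integrand (fun z =>
      (∑ i ∈ Finset.range (n + 1), c i (Fin.init z) * z (Fin.last b) ^ i) /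
        (A (Fin.init z) + B (Fin.init z) * z (Fin.last b))) r.domain) :
    ∃ (T : RTerm b) (hT : T.Admissible), FoldsTo r T hT := by
  classical
  -- split 1: `A = 0` vs `A ≠ 0`
  have hPAs : IsSemialgebraic ℚ {x | x ∈ G ∧ A x = 0} := isSemialgebraic_sep_eq_zero hA
  have hG₁s : IsSemialgebraic ℚ {x | x ∈ G ∧ A x ≠ 0} := isSemialgebraic_sep_ne_zero hG hA
  refine foldsTo_of_base_split r hPAs hG₁s hdom (fun x hx => hx.1) (fun x hx => hx.1)
    (fun x hx => ?_) (Set.disjoint_left.2 fun x hx hx' => hx'.2 hx.2) ?_ ?_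
  · by_cases h0 : A x = 0
    · exact Or.inl ⟨hx, h0⟩
    · exact Or.inr ⟨hx, h0⟩
  · intro hs hsub
    exact foldsTo_ratDegOne_pieceA (r.restrict _ hs hsub) hPAs n
      (fun i => (hc i).mono (fun x hx => hx.1) hPAs) (hB.mono (fun x hx => hx.1) hPAs)
      (fun x hx => hx.2)
      (fun x hx hB0 => hne x hx.1 (1 / 2) ⟨by norm_num, by norm_num⟩ (by rw [hx.2, hB0]; ring))
      rfl (fun z hz => hint (hsub hz))
  · intro hs hsub
    -- split 2 (inside `A ≠ 0`): `A + B = 0` vs `A + B ≠ 0`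
    set G₁ : Set (Fin b → ℝ) := {x | x ∈ G ∧ A x ≠ 0} with hG₁
    have hA₁ : IsSemialgebraicFunOn ℚ G₁ A := hA.mono (fun x hx => hx.1) hG₁s
    have hB₁ : IsSemialgebraicFunOn ℚ G₁ B := hB.mono (fun x hx => hx.1) hG₁s
    have hApB : IsSemialgebraicFunOn ℚ G₁ (fun x => A x + B x) :=
      IsSemialgebraicFunOn.add_holds hA₁ hB₁
    have hP1s : IsSemialgebraic ℚ {x | x ∈ G₁ ∧ A x + B x = 0} := isSemialgebraic_sep_eq_zero hApB
    have hPps : IsSemialgebraic ℚ {x | x ∈ G₁ ∧ A x + B x ≠ 0} :=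
      isSemialgebraic_sep_ne_zero hG₁s hApB
    refine foldsTo_of_base_split (r.restrict _ hs hsub) hP1s hPps rfl (fun x hx => hx.1)
      (fun x hx => hx.1) (fun x hx => ?_) (Set.disjoint_left.2 fun x hx hx' => hx'.2 hx.2) ?_ ?_
    · by_cases h0 : A x + B x = 0
      · exact Or.inl ⟨hx, h0⟩
      · exact Or.inr ⟨hx, h0⟩
    · intro hs' hsub'
      exact foldsTo_ratDegOne_pieceOne ((r.restrict _ hs hsub).restrict _ hs' hsub') hP1s n
        (fun i => (hc i).mono (fun x hx => hx.1.1) hP1s) (hA.mono (fun x hx => hx.1.1) hP1s)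
        (fun x hx => hx.1.2) (fun x hx => hx.2) rfl (fun z hz => hint (hsub (hsub' hz)))
    · intro hs' hsub'
      -- split 3 (inside `A ≠ 0`, `A + B ≠ 0`): `|B/A| < q` vs `q ≤ |B/A|`, `q ∈ ℚ ∩ (0, η₁)`
      set Pp : Set (Fin b → ℝ) := {x | x ∈ G₁ ∧ A x + B x ≠ 0} with hPp
      obtain ⟨η₁, hη₁, cT, hcT, hTay⟩ := Plan.kernelIndependenceTaylor n
      obtain ⟨q, hq0, hq1⟩ := exists_rat_btwn hη₁
      have hAp : IsSemialgebraicFunOn ℚ Pp A := hA.mono (fun x hx => hx.1.1) hPps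
      have hBp : IsSemialgebraicFunOn ℚ Pp B := hB.mono (fun x hx => hx.1.1) hPps
      have hκp : IsSemialgebraicFunOn ℚ Pp (fun x => B x / A x) := hBp.div hAp fun x hx => hx.1.2
      have hPTs : IsSemialgebraic ℚ {x | x ∈ Pp ∧ |B x / A x| < q} := by
        have h1 := isSemialgebraic_sep_lt hκp (isSemialgebraicFunOn_ratCast hPps q)
        have h2 := isSemialgebraic_sep_lt (isSemialgebraicFunOn_ratCast hPps (-q)) hκp
        convert Literature.ModelTheory.ExponentialFields.IsSemialgebraic.inter h1 h2 using 1
        ext x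
        simp only [mem_setOf_eq, mem_inter_iff, abs_lt, Rat.cast_neg]
        tauto
      have hPWs : IsSemialgebraic ℚ {x | x ∈ Pp ∧ (q : ℝ) ≤ |B x / A x|} := by
        convert hPps.diff hPTs using 1
        ext x
        simp only [mem_setOf_eq, Set.mem_sdiff, not_and, not_lt]
        tauto
      refine foldsTo_of_base_split ((r.restrict _ hs hsub).restrict _ hs' hsub') hPTs hPWs rfl
        (fun x hx => hx.1) (fun x hx => hx.1) (fun x hx => ?_)
        (Set.disjoint_left.2 fun x hx hx' => (not_lt.2 hx'.2) hx.2) ?_ ?_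
      · by_cases hlt : |B x / A x| < q
        · exact Or.inl ⟨hx, hlt⟩
        · exact Or.inr ⟨hx, not_lt.1 hlt⟩
      · intro hs'' hsub''
        exact foldsTo_ratDegOne_pieceTaylor
          (((r.restrict _ hs hsub).restrict _ hs' hsub').restrict _ hs'' hsub'') hPTs n
          (fun i => (hc i).mono (fun x hx => hx.1.1.1) hPTs)
          (hA.mono (fun x hx => hx.1.1.1) hPTs) (hB.mono (fun x hx => hx.1.1.1) hPTs)
          (fun x hx => hx.1.1.2) (fun x hx => hx.1.2) (fun x hx => hne x hx.1.1.1)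
          ⟨cT, hcT, hTay⟩ (fun x hx => hx.2.le.trans hq1.le) rfl
          (fun z hz => hint (hsub (hsub' (hsub'' hz))))
      · intro hs'' hsub''
        exact foldsTo_ratDegOne_pieceHorner
          (((r.restrict _ hs hsub).restrict _ hs' hsub').restrict _ hs'' hsub'') hPWs n
          (fun i => (hc i).mono (fun x hx => hx.1.1.1) hPWs)
          (hA.mono (fun x hx => hx.1.1.1) hPWs) (hB.mono (fun x hx => hx.1.1.1) hPWs)
          (fun x hx => hx.1.1.2) (fun x hx => hx.1.2) (fun x hx => hne x hx.1.1.1)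
          hq0 (fun x hx => hx.2) rfl
          (fun z hz => hint (hsub (hsub' (hsub'' hz))))

end DegOnePieces

/-! ## §11 (g9, NEW) The affine band chart — `t`-degree-`≤ 1` rational integrands over an OPEN BAND fold

NODE-g8 §3quinquies step 2 made honest: the PULLED-BACK REPRESENTATION along
`t = α(x) + (β(x) − α(x))θ` is constructed (integrability by the change-of-variables criterion
`integrableOn_image_iff_integrableOn_abs_det_fderiv_smul`, Jacobian `β − α` by
`LinearMap.det_of_snoc_init`), its integrand is expanded binomially into the §10 form
`(Σ cⱼ(x)θʲ)/(A(x) + B(x)θ)` (`chart_numerator`), §10 folds it, and `FoldsTo.of_affine` (§7)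
carries the folding back to the band. -/

section AffineChart

variable {b : ℕ}

/-- Chart coefficient `cⱼ = σ · Σ_{i ≥ j} pᵢ · C(i,j) · α^{i−j} σ^j` of `σ · Σᵢ pᵢ (α + σθ)ⁱ`. -/
def chartCoeff (n : ℕ) (p : ℕ → ℝ) (α σ : ℝ) (j : ℕ) : ℝ :=
  σ * ∑ i ∈ Finset.range (n + 1),
    if j ≤ i then p i * α ^ (i - j) * σ ^ j * (i.choose j : ℝ) else 0

end AffineChart

end RegularisedLogLayer

end Summit.KontsevichZagierPeriods.RootDecompRelativeModAbsolute.Rung30571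

end
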